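import Mathlib
import Summits.Ventures.HodgeRepro2.Tier7.Line3.LocalFactorProduct

/-!
# Tier7/Line3/LocalFactorClauses — the three per-place clauses as ONE predicate: closed under products, under a change of
the size function, and under the disjoint union of index types (seat t7-x1, gen 5)

LINE 3 (t7-plan-3), version (ii). LocalFactorProduct (p708499) assembles the places `≠ v₁` from per-place data `b x`,
`arith x`, `C x`, `ε x` satisfying three clauses (support / polynomial bound against a size function / non-vanishing
at `γ₀`), and the three per-place KINDS supply exactly these clauses — CompactPlaceFactor (p709575, `compactFactor_clauses`),
UnramifiedFactor (p709130, `unramifiedFactor_clauses`), SplitFactorProduct (p710177, `splitFactor_clauses`, with its OWN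
size `N(I γ) N(J γ)`) — each over its own index type and, for the split kind, its own size. This module makes the
three clauses ONE predicate and proves the three closure properties the assembly «in words» used:

* `PlaceClauses b arith C ε size γ₀ : Prop` — the conjunction of the three clauses in LocalFactorProduct's binder shape;
* `prodFactor_placeClauses`: a finite product of place clauses is a place clause (constants multiplied, exponents
  added — LocalFactorProduct's `prodFactor_support / _bound / _γ₀`);
* `PlaceClauses.of_size_le`: a CHANGE OF SIZE FUNCTION — if `size₁ γ ≤ C₂ (1 + size₂ γ)^c` on the support (`1 ≤ C₂`,
  `0 ≤ c`) then place clauses against `size₁` with exponent `ε` are place clauses against `size₂` with constant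
  `C (2 C₂)^ε` and exponent `ε c` — the passage from the split row's size `N(I γ) N(J γ)` to the dominance size
  (NumeratorIdealSize p714124: `N(I γ) N(J γ) ≤ 6 N(M)² ∏_{(1,1)} (1 + |κ|_w)(1 + |κ − 1|_w)`, a rescaling of `ε` only);
* `placeClauses_disjSum` / `placeClauses_unit`: place clauses over two index types glue over `Finset.disjSum`, and a
  single factor is a place clause over `Unit` — so the three kinds live in ONE index type
  `(ι_S ⊕ ι_unr) ⊕ Unit` and `prodFactor_placeClauses` over it feeds LocalFactorProduct's
  `levelPlace_assembly_inert_prod` (its `hsupp / hbound / hγ₀` are the three projections of `PlaceClauses`).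

WHAT THIS CHANGES IN THE [W] COLUMN: «the places ≠ v₁ per place with the product in words» and «the two displayed size
functions linked by a displayed inequality» (crit-2 STATUS l. 15974 (ii)) → the product of heterogeneous per-place
kinds over one index type is a theorem, and the size conversion is a theorem given the displayed comparison
`size₁ ≤ C₂ (1 + size₂)^c` (which NumeratorIdealSize supplies over `x = κ(γ)` once `I γ, J γ` are the numerator
ideals — that identification stays (a′)). STILL IN WORDS: the identification of each local factor, box count and
ideal with the real one, `T` the finite set of places where the factor is not `1` on the support, the choice
`∑ ε < 1/4`. Nothing here is about (N), (P), the real `X`, or HC_CM; §8(d): NO. Blind lane: Mathlib + the HodgeRepro2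
prefix; no sorry; axioms ⊆ {propext, Classical.choice, Quot.sound}.
-/

namespace Summit.Ventures.HodgeRepro2.Tier7.Line3.LocalFactorClauses

open Summit.Ventures.HodgeRepro2.Tier7.Line3.LocalFactorProduct

variable {Orb : Type*}

/-- **the three per-place clauses**: support, the polynomial bound against `size`, non-vanishing at `γ₀` — at ONE
fixed level (no `N` inside: the level is the consumer's, LevelFactorData's `b N`; crit-2 STATUS l. 16259 (5)). -/
def PlaceClauses (b : Orb → ℂ) (arith : Orb → Prop) (C ε : ℝ) (size : Orb → ℝ) (γ₀ : Orb) : Prop :=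
  (∀ γ, b γ ≠ 0 → arith γ) ∧ (∀ γ, arith γ → ‖b γ‖ ≤ C * (1 + size γ) ^ ε * ‖b γ₀‖) ∧ b γ₀ ≠ 0

/-- **a finite product of place clauses is a place clause** (constants multiplied, exponents added) — through
p708499's `prodFactor_support / _bound / _γ₀` by name, nothing new displayed (`hsize` is `prodFactor_bound`'s binder;
crit-2 STATUS l. 16259 (2)). The product's support predicate is the PER-PLACE conjunction `fun γ => ∀ x ∈ T, arith x γ`
(p708499's `prodFactor_support` conclusion), so the empty index is harmless: at `T = ∅` the product is `1` and the
conjunction is `True` (crit-2 (1)); no `T.Nonempty` is needed. -/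
theorem prodFactor_placeClauses {ι : Type*} (T : Finset ι) (b : ι → Orb → ℂ) (arith : ι → Orb → Prop)
    (C ε : ι → ℝ) (size : Orb → ℝ) (hsize : ∀ γ, 0 ≤ size γ) (γ₀ : Orb)
    (h : ∀ x ∈ T, PlaceClauses (b x) (arith x) (C x) (ε x) size γ₀) :
    PlaceClauses (prodFactor T b) (fun γ => ∀ x ∈ T, arith x γ) (∏ x ∈ T, C x) (∑ x ∈ T, ε x) size γ₀ :=
  ⟨prodFactor_support T b arith fun x hx => (h x hx).1,
    prodFactor_bound T b arith γ₀ C ε size hsize fun x hx => (h x hx).2.1,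
    prodFactor_γ₀ T b γ₀ fun x hx => (h x hx).2.2⟩

/-- `1 + size₁ ≤ 2 C₂ (1 + size₂)^c` from `size₁ ≤ C₂ (1 + size₂)^c` with `1 ≤ C₂`, `0 ≤ c`, `0 ≤ size₂`. -/
theorem one_add_le_of_le {s₁ s₂ C₂ c : ℝ} (hs₂ : 0 ≤ s₂) (hC₂ : 1 ≤ C₂) (hc : 0 ≤ c)
    (hle : s₁ ≤ C₂ * (1 + s₂) ^ c) : 1 + s₁ ≤ 2 * C₂ * (1 + s₂) ^ c := by
  have h1 : 1 ≤ (1 + s₂) ^ c := Real.one_le_rpow (by linarith) hc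
  nlinarith [h1, hC₂]

/-- **a change of the size function**: place clauses against `size₁` with exponent `ε` become place clauses against
`size₂` with constant `C (2 C₂)^ε` and exponent `ε c` once `size₁ γ ≤ C₂ (1 + size₂ γ)^c` ON THE SUPPORT (`arith γ →`;
the bound clause is only asked there — crit-2 STATUS l. 16259 (3)) (`0 ≤ C`, `0 ≤ ε`, both sizes `≥ 0`, `1 ≤ C₂`,
`0 ≤ c`). THE ε-RESCALING is the CONSUMER's business, done once (crit-2 (4)): the dominance consumer asks «∀ ε′ > 0 ∃ C»
and instantiates the split row at `ε := ε′ / c` for `c > 0` (`c = 0` gives exponent `0`, stronger); with the four-factor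
product `∏_{(1,1)} (1 + |κ|_w)(1 + |κ − 1|_w)` as `size₂`, NumeratorIdealSize (p714124) gives `c = 1`,
`C₂ = 6 N(M)²` (`N(I γ) N(J γ) ≤ 6 N(M)² size₂`, hence `≤ C₂ (1 + size₂)`), and with the two-factor size
`∏ (1 + |κ|_w)` it gives `c = 2`, `C₂ = 6 N(M)² 2^{#}` — the identification `I γ = span{M κ(γ)}` stays (a′). -/
theorem PlaceClauses.of_size_le {b : Orb → ℂ} {arith : Orb → Prop} {C ε : ℝ} {size₁ size₂ : Orb → ℝ} {γ₀ : Orb}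
    (h : PlaceClauses b arith C ε size₁ γ₀) (hC : 0 ≤ C) (hε : 0 ≤ ε) (hs₁ : ∀ γ, 0 ≤ size₁ γ)
    (hs₂ : ∀ γ, 0 ≤ size₂ γ) {C₂ c : ℝ} (hC₂ : 1 ≤ C₂) (hc : 0 ≤ c)
    (hle : ∀ γ, arith γ → size₁ γ ≤ C₂ * (1 + size₂ γ) ^ c) :
    PlaceClauses b arith (C * (2 * C₂) ^ ε) (ε * c) size₂ γ₀ := by
  refine ⟨h.1, fun γ hγ => ?_, h.2.2⟩
  have hpos : 0 ≤ 1 + size₂ γ := by linarith [hs₂ γ]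
  have h1 : (1 + size₁ γ) ^ ε ≤ ((2 * C₂) ^ ε) * (1 + size₂ γ) ^ (ε * c) := by
    calc (1 + size₁ γ) ^ ε ≤ (2 * C₂ * (1 + size₂ γ) ^ c) ^ ε :=
          Real.rpow_le_rpow (by linarith [hs₁ γ]) (one_add_le_of_le (hs₂ γ) hC₂ hc (hle γ hγ)) hε
      _ = ((2 * C₂) ^ ε) * (1 + size₂ γ) ^ (ε * c) := by
          rw [Real.mul_rpow (by linarith) (Real.rpow_nonneg hpos c), ← Real.rpow_mul hpos, mul_comm c ε]
  calc ‖b γ‖ ≤ C * (1 + size₁ γ) ^ ε * ‖b γ₀‖ := h.2.1 γ hγ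
    _ ≤ C * (((2 * C₂) ^ ε) * (1 + size₂ γ) ^ (ε * c)) * ‖b γ₀‖ :=
        mul_le_mul_of_nonneg_right (mul_le_mul_of_nonneg_left h1 hC) (norm_nonneg _)
    _ = C * (2 * C₂) ^ ε * (1 + size₂ γ) ^ (ε * c) * ‖b γ₀‖ := by ring

/-! ## The three kinds in one index type -/

/-- **place clauses glue over a disjoint union of index types** (`Finset.disjSum`). -/
theorem placeClauses_disjSum {ι₁ ι₂ : Type*} (T₁ : Finset ι₁) (T₂ : Finset ι₂) (b₁ : ι₁ → Orb → ℂ)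
    (b₂ : ι₂ → Orb → ℂ) (a₁ : ι₁ → Orb → Prop) (a₂ : ι₂ → Orb → Prop) (C₁ ε₁ : ι₁ → ℝ) (C₂ ε₂ : ι₂ → ℝ)
    (size : Orb → ℝ) (γ₀ : Orb) (h₁ : ∀ x ∈ T₁, PlaceClauses (b₁ x) (a₁ x) (C₁ x) (ε₁ x) size γ₀)
    (h₂ : ∀ y ∈ T₂, PlaceClauses (b₂ y) (a₂ y) (C₂ y) (ε₂ y) size γ₀) :
    ∀ z ∈ T₁.disjSum T₂, PlaceClauses (Sum.elim b₁ b₂ z) (Sum.elim a₁ a₂ z) (Sum.elim C₁ C₂ z)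
      (Sum.elim ε₁ ε₂ z) size γ₀ := by
  intro z hz
  rcases z with x | y
  · exact h₁ x (Finset.inl_mem_disjSum.1 hz)
  · exact h₂ y (Finset.inr_mem_disjSum.1 hz)

/-- **a single factor is a place clause over `Unit`** (the split product of SplitFactorProduct as ONE index). -/
theorem placeClauses_unit (b : Orb → ℂ) (arith : Orb → Prop) (C ε : ℝ) (size : Orb → ℝ) (γ₀ : Orb)
    (h : PlaceClauses b arith C ε size γ₀) :
    ∀ z ∈ (Finset.univ : Finset Unit), PlaceClauses ((fun _ => b) z) ((fun _ => arith) z) ((fun _ => C) z)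
      ((fun _ => ε) z) size γ₀ :=
  fun _ _ => h

/-- **the three kinds as one product**: the `S`-places (`T₁`), the unramified inert places (`T₂`) and the split
product (one index) give ONE place clause over `(ι₁ ⊕ ι₂) ⊕ Unit` — the `hsupp / hbound / hγ₀` of LocalFactorProduct's
`levelPlace_assembly_inert_prod` are its three projections (`.1`, `.2.1`, `.2.2`, the per-place binders
`hsupp : ∀ x ∈ T, ∀ γ, b x γ ≠ 0 → arith x γ` etc. being what `prodFactor_placeClauses` consumes). The `Unit` summand
(the split product) is always present, so the index is never empty; `T₁`, `T₂` may be empty (crit-2 STATUS l. 16259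
(1)). -/
theorem placeClauses_three_kinds {ι₁ ι₂ : Type*} (T₁ : Finset ι₁) (T₂ : Finset ι₂) (b₁ : ι₁ → Orb → ℂ)
    (b₂ : ι₂ → Orb → ℂ) (b₃ : Orb → ℂ) (a₁ : ι₁ → Orb → Prop) (a₂ : ι₂ → Orb → Prop) (a₃ : Orb → Prop)
    (C₁ ε₁ : ι₁ → ℝ) (C₂ ε₂ : ι₂ → ℝ) (C₃ ε₃ : ℝ) (size : Orb → ℝ) (hsize : ∀ γ, 0 ≤ size γ) (γ₀ : Orb)
    (h₁ : ∀ x ∈ T₁, PlaceClauses (b₁ x) (a₁ x) (C₁ x) (ε₁ x) size γ₀)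
    (h₂ : ∀ y ∈ T₂, PlaceClauses (b₂ y) (a₂ y) (C₂ y) (ε₂ y) size γ₀)
    (h₃ : PlaceClauses b₃ a₃ C₃ ε₃ size γ₀) :
    PlaceClauses (prodFactor ((T₁.disjSum T₂).disjSum (Finset.univ : Finset Unit))
        (Sum.elim (Sum.elim b₁ b₂) (fun _ => b₃)))
      (fun γ => ∀ z ∈ (T₁.disjSum T₂).disjSum (Finset.univ : Finset Unit),
        Sum.elim (Sum.elim a₁ a₂) (fun _ => a₃) z γ)
      (∏ z ∈ (T₁.disjSum T₂).disjSum (Finset.univ : Finset Unit), Sum.elim (Sum.elim C₁ C₂) (fun _ => C₃) z)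
      (∑ z ∈ (T₁.disjSum T₂).disjSum (Finset.univ : Finset Unit), Sum.elim (Sum.elim ε₁ ε₂) (fun _ => ε₃) z)
      size γ₀ :=
  prodFactor_placeClauses _ _ _ _ _ size hsize γ₀
    (placeClauses_disjSum (T₁.disjSum T₂) Finset.univ (Sum.elim b₁ b₂) (fun _ => b₃) (Sum.elim a₁ a₂) (fun _ => a₃)
      (Sum.elim C₁ C₂) (Sum.elim ε₁ ε₂) (fun _ => C₃) (fun _ => ε₃) size γ₀
      (placeClauses_disjSum T₁ T₂ b₁ b₂ a₁ a₂ C₁ ε₁ C₂ ε₂ size γ₀ h₁ h₂)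
      (placeClauses_unit b₃ a₃ C₃ ε₃ size γ₀ h₃))

end Summit.Ventures.HodgeRepro2.Tier7.Line3.LocalFactorClauses
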